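/-!
# (not a line) — moved

This workfile was written by seat b1 by mistake under `Lines/`. It is NOT a skeleton line (no stubs,
no composition). The sketch for the crux idea `dissipative-fp-class` lives at
`Cruxes/EnsembleRealization/Sketch-dissipative-fp-class.lean`. The registered lines of this crux are
`Lines/superposition_lift.lean` (s1) and `Lines/augmented_lift.lean` (b1).
-/
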